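import Mathlib
import Summits.QuantumFields.BalabanUV.Beta.EriceRemainderEnclosureHistoryAutonomyComparisonAgeCompositionStaticChainResolvent
import Summits.QuantumFields.BalabanUV.Beta.EriceRemainderEnclosureHistoryAutonomyComparisonAgeCompositionStaticChainObserverRatios
import Summits.QuantumFields.BalabanUV.Beta.EriceRemainderEnclosureHistoryAutonomyComparisonAgeCompositionStaticChainCrossAmplifications
import Summits.QuantumFields.BalabanUV.Beta.EriceRemainderEnclosureHistoryAutonomyComparisonAgeCompositionStaticChainAdjacentStepLattice
import Summits.QuantumFields.BalabanUV.Beta.EriceRemainderEnclosureHistoryAutonomyComparisonAgeCompositionStaticChainPairCertificate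

/-!
# EriceRemainderEnclosureHistoryAutonomyComparisonAgeCompositionStaticChainPairStepLattice — (E79b) THE GENERIC LATTICE WIRING: the observer step (◆) for
# EVERY level-coupled configuration above an ARBITRARY lattice pair `y > z ≥ 1`, from the envelope facts of the pair (nine numeric inequalities about its
# read windows) and the nine univariate polynomial facts of the generic certificate (E79a)

Cell `pub-balaban`, β-function sub-cell, BINDER row D4 «RemainderConst leaves for Bałaban's split» (`HOME/BINDER-OWNERS.md`; owner lineage `b2b-balaban-beta-an4`;
this file by co-owner #2 lineage `b2b-balaban-beta-d4-p2`, generation 70), β-FLOW TEAM duty (1), FREEZE (0) honoured (def-free; imports (E78b) `…Resolvent`, (E78c)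
`…ObserverRatios`, (E78h) `…CrossAmplifications`, (E78i) `…AdjacentStepLattice` (`rowsum_lt_one`), (E79a) `…PairCertificate` (`pair_step`); nothing restated).

HONEST FRAMING (page 1, verbatim and binding).  *"Discharging BetaPertH makes Bałaban's UV stability UNCONDITIONAL — a real constructive-QFT result; it is
NOT the continuum limit and NOT the Clay problem."*  THIS FILE DISCHARGES NOTHING OF THE KIND.  Finite non-negative linear∕real algebra — hypotheses of a census,
not facts; the age profile of Bałaban's (1.22) limit functional is NOT PRINTED ([I] p. 298; GAPS G-t4-U2-1∕-2) and NOT asserted.  Row D4 class UNCHANGED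
(critical-path width 0; instance 0∕1; D4 DISCHARGE NO DATE).  HONEST DEPENDENCY: continuum YM on T⁴ ⇐ BetaPertH ∧ nine spine estimates (0/9 proved); BetaPertH ⇐
(D1) ∧ (D4) ∧ CAP+tail; G-an2-4 gates asym, D1 and NE2/3/4.

THE POINT (census sense (α); route (N′); README `HOME/b2b-balaban-beta-d4-p2/g70/e79/README.md`).  (E78i) `adjacent_step_lattice` wired an actual level-coupled
configuration above an ADJACENT pair `z ≥ 16` into the scalar step, with the `z ≥ 16` envelope lemmas called by name.  **`pair_step_lattice`** is the same wiring for
an ARBITRARY pair `y > z ≥ 1` with every pair-specific numeric input a LETTER: the instance supplies nine envelope inequalities about the read windows of the pair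
(`S_{y,z}`, `S_{z,y}`, `S_{y,y}`, `S_{y+1,z}` vs `S_{y+1,y}`, `S_{z,y+1}` vs `S_{y,y+1}`, the structural products), the box roundings `cl ≤ r·bl`, `au·bu ≤ ch`,
`(au−r)(bu−bl) ≤ D`, and the nine polynomial facts of (E79a) `pair_step` (for all `Ψ ≥ 0`; here `rl = rh = r = z∕y` and `q = y∕z` are EXACT, so the window room is
transferred by `Ω_z = r·Ω_y` rather than `Ω_z ≤ Ω_y`).  The configuration-level steps are those of (E78i): charge ratios `α_l ∈ [r, au]` ((E78c) `charge_ratio_ge`∕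
`charge_ratio_antitone`), response ratios `cz ∈ [bl, bu]·cy` ((E78c) `read_ratio_ge`∕`read_ratio_antitone`, (E78h) `response_ratio_bounds`), the cross Gram ((E78h)
`cross_gram_bounds`), the structural room ((E78b) `return_amplification_ge_lattice`, (E78i) `rowsum_lt_one`).  WHAT THIS BUYS: every geometry class of the observer
induction is now ONE short instance file (rational constants, `nlinarith` on polynomials with positive coefficients, a handful of square-root roundings) — the
adjacent pairs `z ≤ 15` first (E79c…), then the `q`-bands.  NOT CLAIMED: any instance; the assembly; the static closure; anything about the flow; printed.

WHAT IS PROVED ([folklore]; 0 `def`, 0 sorry).  **`pair_step_lattice`**.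
-/
noncomputable section
open Finset

namespace Summit.QuantumFields.BalabanUV.Beta.EriceRemainderEnclosureHistoryAutonomyComparisonAgeCompositionStaticChainPairStepLattice

open Summit.QuantumFields.BalabanUV.Beta.EriceRemainderEnclosureHistoryAutonomyComparisonAgeCompositionStaticChainCertificate
open Summit.QuantumFields.BalabanUV.Beta.EriceRemainderEnclosureHistoryAutonomyComparisonAgeCompositionStaticChainResolvent
open Summit.QuantumFields.BalabanUV.Beta.EriceRemainderEnclosureHistoryAutonomyComparisonAgeCompositionStaticChainObserverRatios
open Summit.QuantumFields.BalabanUV.Beta.EriceRemainderEnclosureHistoryAutonomyComparisonAgeCompositionStaticChainCrossAmplifications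
open Summit.QuantumFields.BalabanUV.Beta.EriceRemainderEnclosureHistoryAutonomyComparisonAgeCompositionStaticChainAdjacentStepLattice
open Summit.QuantumFields.BalabanUV.Beta.EriceRemainderEnclosureHistoryAutonomyComparisonAgeCompositionStaticChainPairCertificate
set_option maxHeartbeats 400000 in
/-- **THE OBSERVER STEP (◆) FOR EVERY LEVEL-COUPLED CONFIGURATION ABOVE AN ARBITRARY PAIR `y > z ≥ 1`.**  Letters: `n ≥ 1` older ages `k_l ≥ y+1`, loads
`x_l ≥ 0`; read windows `Sy_l = S_{k_l,y}`, `Sz_l = S_{k_l,z}`, `Ry_l = S_{y,k_l}`, `Rz_l = S_{z,k_l}` (`S_{k,j} = Σ_{m<j} √(k∕(k+m+1))`); the array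
`G_{il} = 2x_lS_{k_l,k_i}∕k_l` with exact positive levels `a`; `cy`, `cz` the exact responses to `Ry∕y`, `Rz∕z`; amplifications `Ψyy, Ψyz, Ψzy, Ψzz`; window mass
`Ωz = Σx_lz∕k_l`; `σ = S_{y,z}∕y`, `φ = S_{z,y}∕z`, `s = S_{y,y}∕y`; a defect `θ ≤ th`; the new load `xy ≥ 0` below its cap; `κ ∈ [0,1]`; `r = z∕y`.  ENVELOPE FACTS of
the pair (numeric, supplied by each instance): `sl·y ≤ S_{y,z} ≤ su·y`, `fl·z ≤ S_{z,y} ≤ fu·z`, `slo·y ≤ S_{y,y}` (`sl, fl ≥ 0`, `slo ≥ 1∕2`), the observer-ratio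
ends `S_{y+1,z} ≤ au·S_{y+1,y}` ((E78c) `charge_ratio_antitone`), `bl² z ≤ y` ((E78c) `read_ratio_ge`), `y·S_{z,y+1} ≤ bu·z·S_{y,y+1}` ((E78c) `read_ratio_antitone`),
the box `0 ≤ cl ≤ r·bl`, `au·bu ≤ ch`, `(au − r)(bu − bl) ≤ D`, the structural constants `0 < l1`, `l1·y² ≤ 2S_{y,y+1}S_{y+1,y}`, `r ≤ l2`, `l2·y ≤ 2S_{y+1,y+1}`
((E78b) `return_amplification_ge_lattice`); and the NINE POLYNOMIAL FACTS of (E79a) `pair_step` for all `Ψ ≥ 0` (`rl = rh = r`, `q = y∕z`).  CONCLUSION: the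
hypothesis `hdia` of (E78a) `observer_step` — the observer bound `N_z ≤ (1+2κΨ_zz)(1−Ω_z)` PROPAGATES when the age `y` is added, for every configuration of
older ages and every admissible load.  Proof = (E78i) `adjacent_step_lattice` with `z+1 ↦ y` and the envelope lemmas replaced by letters. [folklore] -/
theorem pair_step_lattice {n y z : ℕ} {k : ℕ → ℕ} {x a cy cz Sy Sz Ry Rz : ℕ → ℝ}
    {κ θ xy Ψyy Ψyz Ψzy Ψzz Ωz σ φ s r sl su fl fu slo au bl bu cl ch D th l1 l2 : ℝ}
    (hκ : 0 ≤ κ) (hκ1 : κ ≤ 1) (hn : 0 < n) (hz : 1 ≤ z) (hzy : z + 1 ≤ y) (hk : ∀ l, l < n → y + 1 ≤ k l) (hx : ∀ l, l < n → 0 ≤ x l)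
    (hSy : ∀ l, l < n → Sy l = ∑ m ∈ range y, Real.sqrt ((k l : ℝ) / ((k l : ℝ) + m + 1)))
    (hSz : ∀ l, l < n → Sz l = ∑ m ∈ range z, Real.sqrt ((k l : ℝ) / ((k l : ℝ) + m + 1)))
    (hRy : ∀ l, l < n → Ry l = ∑ m ∈ range (k l), Real.sqrt ((y : ℝ) / ((y : ℝ) + m + 1)))
    (hRz : ∀ l, l < n → Rz l = ∑ m ∈ range (k l), Real.sqrt ((z : ℝ) / ((z : ℝ) + m + 1)))
    (ha0 : ∀ i, i < n → 0 < a i)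
    (ha : ∀ i, i < n → a i = 1 + ∑ l ∈ range n,
      (2 * x l * (∑ m ∈ range (k i), Real.sqrt ((k l : ℝ) / ((k l : ℝ) + m + 1))) / k l) * a l)
    (hcy : ∀ i, i < n → cy i = Ry i / (y : ℝ) + ∑ l ∈ range n,
      (2 * x l * (∑ m ∈ range (k i), Real.sqrt ((k l : ℝ) / ((k l : ℝ) + m + 1))) / k l) * cy l)
    (hcz : ∀ i, i < n → cz i = Rz i / (z : ℝ) + ∑ l ∈ range n,
      (2 * x l * (∑ m ∈ range (k i), Real.sqrt ((k l : ℝ) / ((k l : ℝ) + m + 1))) / k l) * cz l)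
    (hΨyy : Ψyy = ∑ l ∈ range n, (2 * x l * Sy l / k l) * cy l) (hΨyz : Ψyz = ∑ l ∈ range n, (2 * x l * Sz l / k l) * cy l)
    (hΨzy : Ψzy = ∑ l ∈ range n, (2 * x l * Sy l / k l) * cz l) (hΨzz : Ψzz = ∑ l ∈ range n, (2 * x l * Sz l / k l) * cz l)
    (hΩz : Ωz = ∑ l ∈ range n, x l * (z : ℝ) / k l)
    (hσ : σ = (∑ m ∈ range z, Real.sqrt ((y : ℝ) / ((y : ℝ) + m + 1))) / (y : ℝ))
    (hφ : φ = (∑ m ∈ range y, Real.sqrt ((z : ℝ) / ((z : ℝ) + m + 1))) / (z : ℝ))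
    (hs : s = (∑ m ∈ range y, Real.sqrt ((y : ℝ) / ((y : ℝ) + m + 1))) / (y : ℝ))
    (hr : r = (z : ℝ) / (y : ℝ)) (hθ : θ ≤ th) (hxy : 0 ≤ xy) (hcap : 2 * xy * (s + Ψyy) < 1)
    -- envelope facts of the pair
    (hsl0 : 0 ≤ sl) (hsl : sl * y ≤ ∑ m ∈ range z, Real.sqrt ((y : ℝ) / ((y : ℝ) + m + 1)))
    (hsu : ∑ m ∈ range z, Real.sqrt ((y : ℝ) / ((y : ℝ) + m + 1)) ≤ su * y)
    (hfl0 : 0 ≤ fl) (hfl : fl * z ≤ ∑ m ∈ range y, Real.sqrt ((z : ℝ) / ((z : ℝ) + m + 1)))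
    (hfu : ∑ m ∈ range y, Real.sqrt ((z : ℝ) / ((z : ℝ) + m + 1)) ≤ fu * z)
    (hslo : 1 / 2 ≤ slo) (hslo' : slo * y ≤ ∑ m ∈ range y, Real.sqrt ((y : ℝ) / ((y : ℝ) + m + 1)))
    (hau : ∑ m ∈ range z, Real.sqrt (((y : ℝ) + 1) / (((y : ℝ) + 1) + m + 1)) ≤ au * ∑ m ∈ range y, Real.sqrt (((y : ℝ) + 1) / (((y : ℝ) + 1) + m + 1)))
    (hbl0 : 0 ≤ bl) (hbl : bl ^ 2 * z ≤ y)
    (hbu : (y : ℝ) * ∑ m ∈ range (y + 1), Real.sqrt ((z : ℝ) / ((z : ℝ) + m + 1)) ≤ bu * ((z : ℝ) * ∑ m ∈ range (y + 1), Real.sqrt ((y : ℝ) / ((y : ℝ) + m + 1))))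
    (hcl0 : 0 ≤ cl) (hcl : cl ≤ r * bl) (hch : au * bu ≤ ch) (hD : (au - r) * (bu - bl) ≤ D)
    (hl1 : 0 < l1) (hl1' : l1 * (y : ℝ) ^ 2 ≤ 2 * (∑ m ∈ range (y + 1), Real.sqrt ((y : ℝ) / ((y : ℝ) + m + 1))) *
      (∑ m ∈ range y, Real.sqrt (((y : ℝ) + 1) / (((y : ℝ) + 1) + m + 1))))
    (hl2 : r ≤ l2) (hl2' : l2 * (y : ℝ) ≤ 2 * ∑ m ∈ range (y + 1), Real.sqrt (((y : ℝ) + 1) / (((y : ℝ) + 1) + m + 1)))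
    -- the nine polynomial facts of the generic certificate
    (hFs_lo : ∀ Ψ : ℝ, 0 ≤ Ψ → 0 ≤ 4 * κ * (l1 + (l2 - r) * Ψ) * (sl * fl + sl * bl * Ψ + fl * r * Ψ + Ψ * (cl * Ψ) - D * Ψ ^ 2)
        - (1 + 2 * κ * Ψ) * ((1 + 2 * κ * (cl * Ψ)) * (l1 + (l2 - r) * Ψ) - (1 - th) * (l1 + l2 * Ψ)) - (1 + 2 * κ * (cl * Ψ)) * r * (l1 + l2 * Ψ))
    (hFs_hi : ∀ Ψ : ℝ, 0 ≤ Ψ → 0 ≤ 4 * κ * (l1 + (l2 - r) * Ψ) * (sl * fl + sl * bl * Ψ + fl * r * Ψ + Ψ * (ch * Ψ) - D * Ψ ^ 2)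
        - (1 + 2 * κ * Ψ) * ((1 + 2 * κ * (ch * Ψ)) * (l1 + (l2 - r) * Ψ) - (1 - th) * (l1 + l2 * Ψ)) - (1 + 2 * κ * (ch * Ψ)) * r * (l1 + l2 * Ψ))
    (hF1_lo : ∀ Ψ : ℝ, 0 ≤ Ψ → 0 ≤ 4 * κ * (sl * fl + sl * bl * Ψ + fl * r * Ψ + Ψ * (cl * Ψ) - D * Ψ ^ 2)
        - (1 + 2 * κ * Ψ) * ((1 + 2 * κ * (cl * Ψ)) - (1 - th)) - (1 + 2 * κ * (cl * Ψ)) * r)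
    (hF1_hi : ∀ Ψ : ℝ, 0 ≤ Ψ → 0 ≤ 4 * κ * (sl * fl + sl * bl * Ψ + fl * r * Ψ + Ψ * (ch * Ψ) - D * Ψ ^ 2)
        - (1 + 2 * κ * Ψ) * ((1 + 2 * κ * (ch * Ψ)) - (1 - th)) - (1 + 2 * κ * (ch * Ψ)) * r)
    (hG_lo : ∀ Ψ : ℝ, 0 ≤ Ψ → 0 ≤ (1 + 2 * κ * (cl * Ψ)) * (1 + 2 * κ * Ψ) * r * (l1 + l2 * Ψ)
        - 4 * κ * (su * fu + su * bu * Ψ + fu * au * Ψ + Ψ * (cl * Ψ) + D * Ψ ^ 2) * ((1 + 2 * κ * Ψ - 2 * slo - 2 * Ψ) * (l1 + (l2 - r) * Ψ) + r * (l1 + l2 * Ψ)))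
    (hG_hi : ∀ Ψ : ℝ, 0 ≤ Ψ → 0 ≤ (1 + 2 * κ * (ch * Ψ)) * (1 + 2 * κ * Ψ) * r * (l1 + l2 * Ψ)
        - 4 * κ * (su * fu + su * bu * Ψ + fu * au * Ψ + Ψ * (ch * Ψ) + D * Ψ ^ 2) * ((1 + 2 * κ * Ψ - 2 * slo - 2 * Ψ) * (l1 + (l2 - r) * Ψ) + r * (l1 + l2 * Ψ)))
    (hpole : ∀ Ψ : ℝ, 0 ≤ Ψ → r * (l1 + l2 * Ψ) ≤ 2 * (slo + Ψ) * (l1 + (l2 - r) * Ψ)) :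
    (1 + 2 * κ * Ψzz) * (1 - Ωz) - (1 - θ) * (xy * (1 + 2 * κ * Ψyy))
      ≤ (1 - xy * (1 + 2 * κ * Ψyy)) *
        ((1 + 2 * κ * Ψzz + 4 * κ * xy * ((σ + Ψyz) * (φ + Ψzy)) / (1 - 2 * (s + Ψyy) * xy)) * ((1 - Ωz) - xy / ((y : ℝ) / (z : ℝ)))) := by
  -- positivity of the letters
  have hz' : (1 : ℝ) ≤ z := by exact_mod_cast hz
  have hzp : (0 : ℝ) < z := by linarith
  have hzy' : (z : ℝ) + 1 ≤ y := by exact_mod_cast hzy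
  have hyp : (0 : ℝ) < y := by linarith
  have hy1 : 1 ≤ y := by omega
  have hkpos : ∀ l, l < n → (0 : ℝ) < k l := fun l hl => by have := hk l hl; exact_mod_cast (show 0 < k l by omega)
  have hkge : ∀ l, l < n → (y : ℝ) + 1 ≤ (k l : ℝ) := fun l hl => by exact_mod_cast hk l hl
  have hr0 : 0 < r := by rw [hr]; positivity
  have hrq : 1 / ((y : ℝ) / (z : ℝ)) = r := by rw [hr, one_div_div]
  have hG : ∀ i l, i < n → l < n → 0 ≤ 2 * x l * (∑ m ∈ range (k i), Real.sqrt ((k l : ℝ) / ((k l : ℝ) + m + 1))) / k l :=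
    fun i l hi hl => by
      have := hx l hl; have := hkpos l hl
      have : 0 ≤ ∑ m ∈ range (k i), Real.sqrt ((k l : ℝ) / ((k l : ℝ) + m + 1)) := sum_nonneg fun _ _ => Real.sqrt_nonneg _
      positivity
  have hlev : ∀ i, i < n → 1 + ∑ l ∈ range n, (2 * x l * (∑ m ∈ range (k i), Real.sqrt ((k l : ℝ) / ((k l : ℝ) + m + 1))) / k l) * a l ≤ a i :=
    fun i hi => (ha i hi).symm.le
  have hRy0 : ∀ i, i < n → 0 ≤ Ry i / (y : ℝ) := fun i hi => by
    rw [hRy i hi]; exact div_nonneg (sum_nonneg fun _ _ => Real.sqrt_nonneg _) hyp.le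
  have hcy0 : ∀ i, i < n → 0 ≤ cy i := nonneg_of_response hG ha0 hlev hRy0 hcy
  have hSy0 : ∀ l, l < n → 0 < Sy l := fun l hl => by
    rw [hSy l hl]; apply sum_pos (fun m _ => Real.sqrt_pos.mpr (by have := hkpos l hl; positivity)) (by simp; omega)
  have hS10_0 : 0 < ∑ m ∈ range y, Real.sqrt (((y : ℝ) + 1) / (((y : ℝ) + 1) + m + 1)) :=
    sum_pos (fun m _ => Real.sqrt_pos.mpr (by positivity)) (by simp; omega)
  have hS01_0 : 0 < ∑ m ∈ range (y + 1), Real.sqrt ((y : ℝ) / ((y : ℝ) + m + 1)) :=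
    sum_pos (fun m _ => Real.sqrt_pos.mpr (by positivity)) (by simp)
  have hau0 : 0 ≤ au := by
    have h0 : 0 ≤ ∑ m ∈ range z, Real.sqrt (((y : ℝ) + 1) / (((y : ℝ) + 1) + m + 1)) := sum_nonneg fun _ _ => Real.sqrt_nonneg _
    by_contra h
    have : au * ∑ m ∈ range y, Real.sqrt (((y : ℝ) + 1) / (((y : ℝ) + 1) + m + 1)) < 0 := mul_neg_of_neg_of_pos (not_le.mp h) hS10_0
    linarith
  -- (A) charge ratios `α_l = Sz_l ∕ Sy_l ∈ [r, au]`
  have hα : ∀ l, l < n → r ≤ Sz l / Sy l ∧ Sz l / Sy l ≤ r + (au - r) := by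
    intro l hl
    have h1 := charge_ratio_ge (k := (k l : ℝ)) (hkpos l hl).le (show z ≤ y by omega)       -- S_{k,y}·z ≤ S_{k,z}·y
    have h2 := charge_ratio_antitone (k := (y : ℝ) + 1) (k' := (k l : ℝ)) (by positivity) (hkge l hl) (show z ≤ y by omega)
      -- S_{k,z} S_{y+1,y} ≤ S_{y+1,z} S_{k,y}
    rw [← hSy l hl, ← hSz l hl] at h1 h2
    constructor
    · rw [hr, div_le_div_iff₀ hyp (hSy0 l hl)]; linarith only [h1]
    · rw [add_sub_cancel, div_le_iff₀ (hSy0 l hl)]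
      -- `Sz · S10 ≤ S_{y+1,z} · Sy ≤ au · S10 · Sy`
      have h3 := mul_le_mul_of_nonneg_right hau (hSy0 l hl).le
      nlinarith only [h2, h3, hS10_0]
  -- (B) response ratios `cz ∈ [bl, bu]·cy` from `Rz∕z ∈ [bl, bu]·Ry∕y`
  have hβ := response_ratio_bounds (βl := bl) (Δβ := bu - bl) (φy := fun i => Ry i / (y : ℝ)) (φz := fun i => Rz i / (z : ℝ)) hG ha0 hlev hcy hcz
    (fun i hi => by
      have h := read_ratio_ge hzp (by linarith : (z:ℝ) ≤ (y:ℝ)) (k i)   -- √(z/y)·Ry ≤ Rz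
      rw [← hRy i hi, ← hRz i hi] at h
      have hRy0' : 0 ≤ Ry i := by rw [hRy i hi]; exact sum_nonneg fun _ _ => Real.sqrt_nonneg _
      -- `bl ≤ √(y/z)`, i.e. `bl·z ≤ √(z/y)·y = √(zy)`
      have hsq : bl * z ≤ Real.sqrt ((z : ℝ) / (y : ℝ)) * y := by
        have e : Real.sqrt ((z : ℝ) / (y : ℝ)) * y = Real.sqrt ((z : ℝ) * y) := by
          rw [show (z : ℝ) * y = (z : ℝ) / y * (y * y) by field_simp, Real.sqrt_mul (by positivity), Real.sqrt_mul_self hyp.le]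
        rw [e]
        refine (Real.le_sqrt (mul_nonneg hbl0 hzp.le) (by positivity)).mpr ?_
        nlinarith only [mul_le_mul_of_nonneg_right hbl hzp.le]
      show bl * (Ry i / (y : ℝ)) ≤ Rz i / (z : ℝ)
      rw [mul_div_assoc', div_le_div_iff₀ hyp hzp]
      have := mul_le_mul_of_nonneg_right hsq hRy0'
      nlinarith only [mul_le_mul_of_nonneg_right h hyp.le, mul_le_mul_of_nonneg_right hsq hRy0', hRy0'])
    (fun i hi => by
      have h := read_ratio_antitone hzp (by linarith : (z:ℝ) ≤ (y:ℝ)) (show y + 1 ≤ k i from hk i hi)   -- S_{z,k} S_{y,y+1} ≤ S_{z,y+1} S_{y,k}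
      rw [← hRy i hi, ← hRz i hi] at h
      have hRy0' : 0 ≤ Ry i := by rw [hRy i hi]; exact sum_nonneg fun _ _ => Real.sqrt_nonneg _
      show Rz i / (z : ℝ) ≤ (bl + (bu - bl)) * (Ry i / (y : ℝ))
      rw [add_sub_cancel, mul_div_assoc', div_le_div_iff₀ hzp hyp]
      -- `Rz·y·S01 ≤ S_{z,y+1}·Ry·y ≤ bu·z·S01·Ry`
      have h4 := mul_le_mul_of_nonneg_right hbu hRy0'
      have h5 := mul_le_mul_of_nonneg_right h hyp.le
      nlinarith only [h4, h5, hS01_0, hRy0', hyp])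
  -- (C) the cross Gram through single sums
  have hcross := cross_gram_bounds (n := n) (ey := fun l => 2 * x l * Sy l / k l) (cy := cy) (cz := cz) (α := fun l => Sz l / Sy l)
    (αl := r) (Δα := au - r) (βl := bl) (Δβ := bu - bl)
    (fun l hl => by have := hx l hl; have := hkpos l hl; have := (hSy0 l hl).le; positivity) hcy0 hα hr0.le
    (by have := (hα 0 hn); linarith [this.1, this.2]) hβ hbl0
  have eyz : ∑ i ∈ range n, Sz i / Sy i * (2 * x i * Sy i / k i) * cy i = Ψyz := by
    rw [hΨyz]; exact sum_congr rfl fun i hi => by have := (hSy0 i (mem_range.mp hi)).ne'; field_simp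
  have ezz : ∑ i ∈ range n, Sz i / Sy i * (2 * x i * Sy i / k i) * cz i = Ψzz := by
    rw [hΨzz]; exact sum_congr rfl fun i hi => by have := (hSy0 i (mem_range.mp hi)).ne'; field_simp
  simp only [eyz, ezz, ← hΨyy, ← hΨzy] at hcross
  obtain ⟨⟨hyz1, hyz2⟩, ⟨hzy1, hzy2⟩, ⟨hzz1, hzz2⟩, ⟨hcov1, hcov2⟩⟩ := hcross
  -- (D) the structural room `Ω_y (l1 + l2 Ψyy) ≤ Ψyy`, `Ω_z = r Ω_y`
  have hcy' : ∀ i, i < n → cy i = (∑ m ∈ range (k i), Real.sqrt ((y : ℝ) / ((y : ℝ) + m + 1))) / (y : ℝ) + ∑ l ∈ range n,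
      (2 * x l * (∑ m ∈ range (k i), Real.sqrt ((k l : ℝ) / ((k l : ℝ) + m + 1))) / k l) * cy l := fun i hi => by rw [← hRy i hi]; exact hcy i hi
  have hrow : ∀ i, i < n → 2 * (∑ m ∈ range (y + 1), Real.sqrt (((y : ℝ) + 1) / (((y : ℝ) + 1) + m + 1))) / (y : ℝ)
      * (∑ l ∈ range n, x l * (y : ℝ) / k l) ≤
      ∑ l ∈ range n, 2 * x l * (∑ m ∈ range (k i), Real.sqrt ((k l : ℝ) / ((k l : ℝ) + m + 1))) / k l := by
    intro i hi
    rw [mul_sum]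
    refine sum_le_sum fun l hl => ?_
    have hl' := mem_range.mp hl
    have hSS : (∑ m ∈ range (y + 1), Real.sqrt (((y : ℝ) + 1) / (((y : ℝ) + 1) + m + 1))) ≤ ∑ m ∈ range (k i), Real.sqrt ((k l : ℝ) / ((k l : ℝ) + m + 1)) :=
      calc (∑ m ∈ range (y + 1), Real.sqrt (((y : ℝ) + 1) / (((y : ℝ) + 1) + m + 1)))
          ≤ ∑ m ∈ range (k i), Real.sqrt (((y : ℝ) + 1) / (((y : ℝ) + 1) + m + 1)) := readWindow_mono_right _ (hk i hi)
        _ ≤ _ := Summit.QuantumFields.BalabanUV.Beta.EriceRemainderEnclosureHistoryAutonomyComparisonAgeCompositionStaticChainWindowMass.readWindow_mono_left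
            (by positivity) (hkge l hl') (k i)
    have hxl := hx l hl'; have hkl := hkpos l hl'
    rw [show 2 * (∑ m ∈ range (y + 1), Real.sqrt (((y : ℝ) + 1) / (((y : ℝ) + 1) + m + 1))) / (y : ℝ) * (x l * (y : ℝ) / k l)
        = 2 * x l * (∑ m ∈ range (y + 1), Real.sqrt (((y : ℝ) + 1) / (((y : ℝ) + 1) + m + 1))) / k l by field_simp]
    exact div_le_div_of_nonneg_right (by nlinarith only [hSS, hxl]) hkl.le
  have hγ1 := rowsum_lt_one hn hG ha0 hlev hrow
  have hstruct := return_amplification_ge_lattice (n := n) (y := y) (k := k) (x := x) (a := a) (c := cy) hy1 hk hx ha0 ha hcy' hγ1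
  have eΨ : ∑ l ∈ range n, 2 * x l * (∑ m ∈ range y, Real.sqrt ((k l : ℝ) / ((k l : ℝ) + m + 1))) / k l * cy l = Ψyy := by
    rw [hΨyy]; exact sum_congr rfl fun l hl => by rw [hSy l (mem_range.mp hl)]
  rw [eΨ] at hstruct
  -- abbreviations
  set S11 := ∑ m ∈ range (y + 1), Real.sqrt (((y : ℝ) + 1) / (((y : ℝ) + 1) + m + 1)) with hS11
  set S01 := ∑ m ∈ range (y + 1), Real.sqrt ((y : ℝ) / ((y : ℝ) + m + 1)) with hS01
  set S10 := ∑ m ∈ range y, Real.sqrt (((y : ℝ) + 1) / (((y : ℝ) + 1) + m + 1)) with hS10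
  set Ωy := ∑ l ∈ range n, x l * (y : ℝ) / k l with hΩy
  clear_value S11 S01 S10 Ωy
  have hΩy0 : 0 ≤ Ωy := by rw [hΩy]; exact sum_nonneg fun l hl => by have := hx l (mem_range.mp hl); have := hkpos l (mem_range.mp hl); positivity
  have hden : 0 < 1 - 2 * S11 / (y : ℝ) * Ωy := by linarith only [hγ1]
  have hΨ0 : 0 ≤ Ψyy := by
    rw [hΨyy]; exact sum_nonneg fun l hl => mul_nonneg (by have := hx l (mem_range.mp hl); have := hkpos l (mem_range.mp hl); have := (hSy0 l (mem_range.mp hl)).le; positivity) (hcy0 l (mem_range.mp hl))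
  have hroom_y : Ωy * (l1 + l2 * Ψyy) ≤ Ψyy := by
    have h1 : S01 / (y : ℝ) * (2 * S10 / (y : ℝ)) * Ωy ≤ Ψyy * (1 - 2 * S11 / (y : ℝ) * Ωy) := by
      rw [← div_le_iff₀ hden]; exact hstruct
    have e1 : S01 / (y : ℝ) * (2 * S10 / (y : ℝ)) = (2 * S01 * S10) / ((y : ℝ) ^ 2) := by
      rw [div_mul_div_comm]; ring
    have hL1 : l1 ≤ S01 / (y : ℝ) * (2 * S10 / (y : ℝ)) := by
      rw [e1, le_div_iff₀ (by positivity)]; nlinarith only [hl1']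
    have hL2 : l2 ≤ 2 * S11 / (y : ℝ) := by rw [le_div_iff₀ hyp]; linarith only [hl2']
    nlinarith only [h1, mul_le_mul_of_nonneg_right hL1 hΩy0, mul_le_mul_of_nonneg_right hL2 (mul_nonneg hΩy0 hΨ0), hΩy0, hΨ0]
  have hΩzy : Ωz = r * Ωy := by
    rw [hΩz, hΩy, hr, mul_sum]; exact sum_congr rfl fun l hl => by
      have hkl := (hkpos l (mem_range.mp hl)).ne'
      field_simp
  have hΩz0 : 0 ≤ Ωz := by rw [hΩzy]; exact mul_nonneg hr0.le hΩy0
  have hroom : Ωz * (l1 + l2 * Ψyy) ≤ r * Ψyy := by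
    rw [hΩzy, mul_assoc]; exact mul_le_mul_of_nonneg_left hroom_y hr0.le
  -- (E) envelopes of `σ, φ, s`
  have hσ1 : sl ≤ σ := by rw [hσ, le_div_iff₀ hyp]; exact hsl
  have hσ2 : σ ≤ su := by rw [hσ, div_le_iff₀ hyp]; exact hsu
  have hφ1 : fl ≤ φ := by rw [hφ, le_div_iff₀ hzp]; exact hfl
  have hφ2 : φ ≤ fu := by rw [hφ, div_le_iff₀ hzp]; exact hfu
  have hs1 : slo ≤ s := by rw [hs, le_div_iff₀ hyp]; exact hslo'
  -- (F) the generic scalar step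
  have hq : 0 < (y : ℝ) / (z : ℝ) := by positivity
  have hcov1' : Ψyy * Ψzz - D * Ψyy ^ 2 ≤ Ψyz * Ψzy := by nlinarith only [hcov1, hD, sq_nonneg Ψyy]
  have hcov2' : Ψyz * Ψzy ≤ Ψyy * Ψzz + D * Ψyy ^ 2 := by nlinarith only [hcov2, hD, sq_nonneg Ψyy]
  have hzz1' : cl * Ψyy ≤ Ψzz := by nlinarith only [hzz1, hcl, hΨ0]
  have hzz2' : Ψzz ≤ ch * Ψyy := by nlinarith only [hzz2, hch, hΨ0]
  exact pair_step (q := (y : ℝ) / (z : ℝ)) (rl := r) (rh := r) hκ hκ1 hΨ0 hq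
    (by linarith only [hyz1]) (by linarith only [hyz2]) (by linarith only [hzy1]) (by linarith only [hzy2]) hzz1' hzz2'
    hcov1' hcov2' hΩz0 hroom hl1 hl2 hθ hsl0 hσ1 hσ2 hfl0 hφ1 hφ2 hslo hs1 hr0.le hbl0 hcl0 (by rw [hrq]) (by rw [hrq])
    (hFs_lo Ψyy hΨ0) (hFs_hi Ψyy hΨ0) (hF1_lo Ψyy hΨ0) (hF1_hi Ψyy hΨ0)
    (hG_lo Ψyy hΨ0) (hG_hi Ψyy hΨ0) (hG_lo Ψyy hΨ0) (hG_hi Ψyy hΨ0) (hpole Ψyy hΨ0) hxy hcap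

end Summit.QuantumFields.BalabanUV.Beta.EriceRemainderEnclosureHistoryAutonomyComparisonAgeCompositionStaticChainPairStepLattice

end
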